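import Literature.Analysis.FluidPDE.ChaeAsymptoticallySelfSimilar
import Literature.Analysis.FluidPDE.SelfSimilarCollapseAnsatz
import Literature.Analysis.FluidPDE.NSVorticity
import HarnessLib

/-!
# Chae 2010: Type-II asymptotically self-similar Navier–Stokes blow-up with a global `L^p`
# profile is empty (Thm 1.4), and the Type-I threshold `limsup (T−t)‖∇v‖_∞ ≥ 1` for Euler
# blow-up (Thm 1.1) with its self-similar corollary `‖∇V̄‖_∞ ≥ 1` (Cor 1.1) — named facts and
# a proved consequence

Analysis/FluidPDE statements file (two NAMED FACTS with cite tags, everything else proved),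
companion of `ChaeAsymptoticallySelfSimilar.lean` (Chae 2007, Math. Ann.: asymptotically
self-similar singularities at the LERAY scaling, `chae2007_asymptoticallySelfSimilar_local`) and of
`SelfSimilarCollapseAnsatz.lean` (the power-law ansatz `selfSimilarCollapse γ T U`,
`u(t,x) = (T−t)^{γ−1} U(x/(T−t)^γ)`; Chae's `α` is `1/γ − 1`). Source: D. Chae, *On the
generalized self-similar singularities for the Euler and the Navier–Stokes equations*, J. Funct.
Anal. 258 (2010) 2865–2883 = arXiv:0711.1113 (arXiv title: *On the blow-up problem and new a
priori estimates for the 3D Euler and the Navier–Stokes equations*); the arXiv text carries the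
displays that the held journal extraction garbles (arXiv Thm 3.1 = JFA Thm 1.4; arXiv Thm 1.1 =
JFA Thm 1.1; arXiv Cor 1.1 / JFA Cor 1.1–1.2).

* `chae2010_typeII_asymptoticallySelfSimilar` — **JFA Theorem 1.4** (= arXiv Thm 3.1):
  "Let `p ∈ [3, ∞)` and `v ∈ C([0,T); L^p(ℝ³))` be a local classical solution of the Navier–Stokes
  equations constructed by Kato. Suppose there exist `γ > 1` and `V̄ ∈ L^p(ℝ³)` such that
  `lim_{t→T} (T−t)^{(p−3)γ/(2p)} ‖v(·,t) − (T−t)^{−γ/2} V̄(·/(T−t)^{γ/2})‖_{L^p} = 0`. If the blow-up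
  profile `V̄` belongs to `Ḣ¹(ℝ³)`, then `V̄ = 0`." — a POWER-LAW TYPE II scenario (length scale
  `λ(t) = (T−t)^{γ/2}` collapsing faster than `√(T−t)`, velocity `∼ λ⁻¹`, so
  `‖∇v‖_∞ ∼ (T−t)^{−γ}`, `γ > 1`, the rate (1.18) of the source) with a GLOBAL `L^p`-convergent
  profile has only the trivial profile in `Ḣ¹`. Printed mechanism (arXiv §3, proof of Thm 3.1): in the similarity
  variables the modulation coefficient `−γ/(2s(γ−1) + 2T^{1−γ})` of `V + (y·∇)V` tends to `0`, so the
  limit `V̄` is a STATIONARY weak solution of Navier–Stokes, `(V̄·∇)V̄ = ΔV̄ − ∇P̄`, and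
  `V̄ ∈ Ḣ¹ ∩ L^p` gives `∫|∇V̄|² = 0`.
* `chae2010_euler_typeI_threshold` — **JFA Theorem 1.1** (= arXiv Thm 1.1): "Let `m > 5/2`,
  and `v ∈ C([0,T); H^m(ℝ³))` be a solution to (E) with `v₀ ∈ H^m(ℝ³)`, `div v₀ = 0`. We set
  `limsup_{t→T} (T−t)‖∇v(t)‖_{L^∞} =: M(T)`. Then, either `M(T) = 0` or `M(T) ≥ 1`. The former case
  corresponds to non blow-up, and the latter case corresponds to the blow-up at `T`." (proof:
  `‖ω(t)‖_∞ ≤ ‖ω(t₀)‖_∞ ((T−t₀)/(T−t))^{M₀}` along particle trajectories, `M₀ < 1` makes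
  `∫‖ω‖_∞ dt` finite, Beale–Kato–Majda). Rendered, as the tree's Constantin–Ignatova–Vicol fact
  `CIV2026_collapseExponent_ge_two_fifths` renders "local smooth Euler solution" and "does not blow
  up at `T`", in the Beale–Kato–Majda class of `NSVorticity.lean`: `M(T) < 1` ⇒ the solution
  CONTINUES in the class past `T` (`HasSobolevExtensionPast 0 u T`).
* PROVED from the latter, **JFA Corollary 1.1** (JFA §1: "There exists no
  self-similar blow-up for the solution of the 3D Euler equations with the blow-up profile `V̄`
  satisfying `‖∇V̄‖_{L^∞} < 1`"): if on `[t₀, T)` the solution IS the exact power-law ansatz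
  `selfSimilarCollapse γ T U` with `sup ‖DU‖ < 1`, then `(T−t)‖D(u t)‖ = ‖DU‖ < 1`
  (`fderiv_selfSimilarCollapse`: `D(u(t)) = (T−t)^{−1} DU(y)`, for EVERY exponent `γ`) and the
  solution continues past `T` — `chae2010_euler_typeI_threshold.selfSimilarCollapse_continues`. The
  constraint is scale-invariant: the profile equation is invariant under
  `U ↦ λ^{−1}U(λ·)`, `P ↦ λ^{−2}P(λ·)`, which fixes `‖DU‖_∞`; so every putative exact self-similar
  Euler blow-up profile from data in the class has `sup ‖DU‖ ≥ 1`, whatever its collapse exponent.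

## Rendering (read before citing)

* **NS class (Thm 1.4)**, verbatim the class of `chae2007_asymptoticallySelfSimilar_local`:
  `IsClassicalNSSolutionOn (Ioo 0 T) 1 0 v π` (classical on the open interval, `ν = 1`, no force)
  with `ContinuousInLpOn (Ico 0 T) p v` (`v ∈ C([0,T); L^p)`, Kato's class), `p ∈ [3, ∞)` an
  `ℝ≥0`; `V̄ ∈ L^p` is `MemLp V p volume`; "`V̄ ∈ Ḣ¹(ℝ³)`" is rendered "`V̄` has a weak gradient in
  `L²`", `eWeakGradL2Sq V < ⊤` (`VectorCalculus.lean`; junk value `⊤` when no weak gradient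
  exists, so the hypothesis says exactly `∇V̄ ∈ L²`); the conclusion `V̄ = 0` is a.e. The displayed
  convergence is the quantity `chaeTypeIIDeviation T γ p v V t → 0` as `t ↑ T` (below), written
  verbatim with the comparison field `(T−t)^{−γ/2} V̄(x/(T−t)^{γ/2})` (velocity scale `λ⁻¹`,
  length scale `λ = (T−t)^{γ/2}`: the Navier–Stokes-covariant normalisation of the source's
  similarity transform (1.21)–(1.23), whose modulated equation is the display before (1.27) /
  arXiv §3) and
  the prefactor `(T−t)^{(p−3)γ/(2p)} = λ^{1−3/p}`, which makes the quantity equal to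
  `‖λ v(λ·, t) − V̄‖_{L^p}` — the form "`lim_{s→∞} ‖V(·,s) − V̄‖_{L^p} = 0`" in which the proof uses it.
* **Euler class (Thm 1.1)**: the BKM class of `NSVorticity.lean` exactly as in
  `CIV2026_collapseExponent_ge_two_fifths` — `IsClassicalEulerSolutionOn (Ico 0 T) 0 u p` with
  `HasBoundedSobolevNormsOn (Icc 0 T'') u` for every `T'' < T` (print's `C([0,T); H^m)`,
  `m > 5/2`, is one Sobolev index; the tree's class asks all of them, which makes the fact WEAKER
  than print), "non blow-up at `T`" = `HasSobolevExtensionPast 0 u T` (continuation in the class,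
  the conclusion of the tree's `beale_kato_majda`), and "`M(T) < 1`" = "`(T−t)‖D(v(t))(x)‖ ≤ M₀`
  for all `x` and all `t ∈ [t₀, T)`, some `M₀ < 1`, `t₀ ∈ [0,T)`" (equivalent to
  `limsup_{t→T} (T−t)‖∇v(t)‖_∞ < 1` for the continuous `∇v`).

## What is deliberately NOT here

No proofs of the two facts (Thm 1.4: similarity variables, weak stationary limit, energy identity
for `Ḣ¹ ∩ L^p` steady solutions; Thm 1.1: Lagrangian transport of `|ω|` + BKM — the tree's BKM
criterion `beale_kato_majda_holds` is available but the sup-norm vorticity transport bound along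
particle trajectories in the `H^m` class is not). JFA Theorem 1.2 (no `α`-asymptotically
self-similar Type-I blow-up in `L^p` when `M < |1 − 3/((α+1)p)|` and `ω₀ ∈ L^p`), Corollaries
1.2–1.3 (`Ω̄ ∈ L^p`, the energy-forced `α = 3/2`; = Chae, Comm. Math. Phys. 273 (2007) Thm 1.1)
and Theorem 1.3 (Euler Type II: the local `L²` profile is a stationary weak Euler solution) are
NOT typed. Nothing here asserts or denies blow-up for any datum.

## References

* D. Chae, J. Funct. Anal. 258 (2010) 2865–2883, doi:10.1016/j.jfa.2010.02.006 = arXiv:0711.1113: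
  §1 Thm 1.1, Cor 1.1; Thm 1.4 (= arXiv §3, Thm 3.1). Locators checked in the held texts
  `paper:doi-10-1016-j-jfa-2010-02-006` (chunks 3–6) and `paper:arxiv-0711.1113` (chunks 3–4, 8),
  whose chunk numbers are NOT journal pages. [Chae2010]
* D. Chae, Math. Ann. 338 (2007) 435–449 = arXiv:math/0604234, Thm 1.5 (the Leray-scaling
  companion, tree `chae2007_asymptoticallySelfSimilar_local`). [Chae2007]
* J. T. Beale, T. Kato, A. Majda, Comm. Math. Phys. 94 (1984) 61–66, Thm 1 (tree
  `beale_kato_majda`). [BealeKatoMajda1984]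
* P. Constantin, M. Ignatova, V. Vicol, arXiv:2602.17570, §3.1 (3.2) (the ansatz
  `selfSimilarCollapse`). [ConstantinIgnatovaVicol2026Putative]
-/

noncomputable section

open _root_.MeasureTheory Set Function Filter Metric
open scoped NNReal ENNReal _root_.Topology

namespace Literature.Analysis.FluidPDE

/-- Local notation for physical space `ℝ³ = EuclideanSpace ℝ (Fin 3)`. -/
local notation "ℝ³" => EuclideanSpace ℝ (Fin 3)

/-! ### Navier–Stokes: Type-II asymptotically self-similar blow-up (JFA Thm 1.4) -/

/-- Chae's scaled GLOBAL deviation of `v(t)` from the Type-II self-similar field with profile `V`,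
rate `γ` and blow-up time `T` (the quantity under `lim_{t→T}` in JFA Thm 1.4 / arXiv (3.1)):
`(T−t)^{(p−3)γ/(2p)} · ‖v(·,t) − (T−t)^{−γ/2} V(·/(T−t)^{γ/2})‖_{L^p(ℝ³)}`, an honest `ℝ≥0∞`
(`∞` if the slice difference is not in `L^p`). With `λ = (T−t)^{γ/2}` it equals
`‖λ v(λ·, t) − V‖_{L^p}`. Meaningful for `t < T`. [cite: Chae2010, Thm 1.4 (the displayed hypothesis; arXiv:0711.1113 (3.1))] -/
def chaeTypeIIDeviation (T γ : ℝ) (p : ℝ≥0) (v : ℝ → ℝ³ → ℝ³) (V : ℝ³ → ℝ³) (t : ℝ) : ℝ≥0∞ :=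
  ENNReal.ofReal ((T - t) ^ (((p : ℝ) - 3) * γ / (2 * (p : ℝ)))) *
    eLpNorm (fun x => v t x - ((T - t) ^ (γ / 2))⁻¹ • V (((T - t) ^ (γ / 2))⁻¹ • x))
      (p : ℝ≥0∞) volume

/-- Unfolding `chaeTypeIIDeviation`. [cite: Chae2010, Thm 1.4] -/
theorem chaeTypeIIDeviation_def (T γ : ℝ) (p : ℝ≥0) (v : ℝ → ℝ³ → ℝ³) (V : ℝ³ → ℝ³) (t : ℝ) :
    chaeTypeIIDeviation T γ p v V t =
      ENNReal.ofReal ((T - t) ^ (((p : ℝ) - 3) * γ / (2 * (p : ℝ)))) *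
        eLpNorm (fun x => v t x - ((T - t) ^ (γ / 2))⁻¹ • V (((T - t) ^ (γ / 2))⁻¹ • x))
          (p : ℝ≥0∞) volume :=
  rfl

/-- **Chae 2010, Theorem 1.4** (J. Funct. Anal. 258 (2010), Thm 1.4 = arXiv:0711.1113,
Thm 3.1: "Let `p ∈ [3, ∞)` and `v ∈ C([0, T); L^p(ℝ³))` be a local classical solution of
the Navier–Stokes equations constructed by Kato. Suppose there exist `γ > 1` and `V̄ ∈ L^p(ℝ³)`
such that the following convergence holds true:
`lim_{t→T} (T−t)^{(p−3)γ/(2p)} ‖v(·,t) − (T−t)^{−γ/2} V̄(·/(T−t)^{γ/2})‖_{L^p} = 0`. If the blow-up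
profile `V̄` belongs to `Ḣ¹(ℝ³)`, then `V̄ = 0`."; proof (arXiv §3): the rescaled `V(·,s) → V̄` in `L^p`,
the modulation coefficient `γ/(2s(γ−1)+2T^{1−γ}) → 0`, so `V̄` is a stationary weak Navier–Stokes
solution, and `V̄ ∈ Ḣ¹ ∩ L^p` forces `∫|∇V̄|² = 0`.) **Statement.** Let `T > 0`, `p ∈ [3, ∞)`,
`(v, π)` a classical solution of Navier–Stokes (`ν = 1`, no force) on `ℝ³ × (0, T)` with
`v ∈ C([0,T); L^p)`, `γ > 1`, and `V ∈ L^p(ℝ³)` with `chaeTypeIIDeviation T γ p v V t → 0` as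
`t ↑ T` and with a weak gradient in `L²` (`eWeakGradL2Sq V < ⊤`). Then `V = 0` a.e.
**Rendering** (module docstring): Kato's class and `L^p`-membership as in
`chae2007_asymptoticallySelfSimilar_local`; `Ḣ¹` as "`∇V ∈ L²` weakly". This is the power-law
TYPE II (`γ > 1`: length scale `(T−t)^{γ/2} ≪ √(T−t)`) companion of the Leray-scaling facts
`chae2007_asymptoticallySelfSimilar_local` / `necas_ruzicka_sverak` / `tsai_selfsimilar`. [cite: Chae2010, Thm 1.4 (= arXiv:0711.1113 Thm 3.1)] -/
def chae2010_typeII_asymptoticallySelfSimilar : Prop :=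
  ∀ ⦃T : ℝ⦄ (_hT : 0 < T) ⦃p : ℝ≥0⦄ (_hp : 3 ≤ p) ⦃v : ℝ → ℝ³ → ℝ³⦄ ⦃π : ℝ → ℝ³ → ℝ⦄
    (_hv : IsClassicalNSSolutionOn (Ioo 0 T) 1 0 v π) (_hvc : ContinuousInLpOn (Ico 0 T) p v)
    ⦃γ : ℝ⦄ (_hγ : 1 < γ) ⦃V : ℝ³ → ℝ³⦄ (_hV : MemLp V (p : ℝ≥0∞) volume)
    (_hconv : Tendsto (chaeTypeIIDeviation T γ p v V) (𝓝[<] T) (𝓝 0))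
    (_hH1 : eWeakGradL2Sq V < ⊤),
    V =ᵐ[volume] 0

/-! ### Euler: the Type-I threshold (JFA Thm 1.1) and its self-similar corollary (Cor 1.1) -/

/-- **Chae 2010, Theorem 1.1** (J. Funct. Anal. 258 (2010), Thm 1.1 = arXiv:0711.1113,
Thm 1.1: "Let `m > 5/2`, and `v ∈ C([0, T); H^m(ℝ³))` be a solution to (E) with `v₀ ∈ H^m(ℝ³)`,
`div v₀ = 0`. We set `limsup_{t→T} (T−t)‖∇v(t)‖_{L^∞} =: M(T)`. Then, either `M(T) = 0` or
`M(T) ≥ 1`. The former case corresponds to non blow-up, and the latter case corresponds to the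
blow-up at `T`. Hence, the blow-up at `T` is of type I if and only if `M(T) ≥ 1`."; proof:
`M(T) < 1` gives `t₀` with `sup_{t₀<t<T} (T−t)‖∇v(t)‖_∞ = M₀ < 1`, transport of `|ω|` along the
particle trajectories gives `‖ω(t)‖_∞ ≤ ‖ω(t₀)‖_∞ ((T−t₀)/(T−t))^{M₀}`, integrable on `(t₀, T)`,
and the Beale–Kato–Majda criterion continues the solution beyond `T`.) **Statement** (the
implication "`M(T) < 1` ⇒ no blow-up at `T`", in the Beale–Kato–Majda class of `NSVorticity.lean`,
as for `CIV2026_collapseExponent_ge_two_fifths`): let `T > 0` and let `(u, p)` be a classical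
unforced Euler solution on `ℝ³ × [0, T)` with all Sobolev norms bounded on every compact
`[0, T''] ⊆ [0, T)`; if for some `M₀ < 1` and `t₀ ∈ [0, T)` one has `(T−t)‖D(u(t))(x)‖ ≤ M₀` for
all `t ∈ [t₀, T)` and all `x`, then `u` continues in the class past `T`
(`HasSobolevExtensionPast 0 u T`). Weaker than print in the class (all Sobolev indices instead of
one `m > 5/2`). [cite: Chae2010, Thm 1.1 (= arXiv:0711.1113 Thm 1.1)] -/
def chae2010_euler_typeI_threshold : Prop :=
  ∀ ⦃T : ℝ⦄ (_hT : 0 < T) ⦃u : ℝ → ℝ³ → ℝ³⦄ ⦃p : ℝ → ℝ³ → ℝ⦄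
    (_hsol : IsClassicalEulerSolutionOn (Ico 0 T) 0 u p)
    (_hreg : ∀ T'' < T, HasBoundedSobolevNormsOn (Icc 0 T'') u)
    (_hM : ∃ M₀ : ℝ, M₀ < 1 ∧ ∃ t₀ ∈ Ico 0 T, ∀ t ∈ Ico t₀ T, ∀ x : ℝ³,
      (T - t) * ‖fderiv ℝ (u t) x‖ ≤ M₀),
    HasSobolevExtensionPast 0 u T

/-- For the exact power-law ansatz the Type-I quantity is the profile's gradient:
`(T−t)‖D(u(t))(x)‖ = ‖DU(y)‖`, `y = x/(T−t)^γ`, for every exponent `γ` and `t < T`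
(`fderiv_selfSimilarCollapse`: `D(u(t)) = (T−t)^{−1} DU(y)`; Chae 2010, proof of Cor 1.1:
"`M(T) = ‖∇V̄‖_{L^∞}`"). [cite: Chae2010, Cor 1.1 (proof)] -/
theorem mul_norm_fderiv_selfSimilarCollapse {γ T t : ℝ} (ht : t < T) (U : ℝ³ → ℝ³) (x : ℝ³) :
    (T - t) * ‖fderiv ℝ (selfSimilarCollapse γ T U t) x‖ =
      ‖fderiv ℝ U ((T - t) ^ (-γ) • x)‖ := by
  have hpos : 0 < T - t := sub_pos.2 ht
  rw [fderiv_selfSimilarCollapse ht U x, norm_smul, Real.rpow_neg_one,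
    Real.norm_of_nonneg (inv_nonneg.2 hpos.le), ← mul_assoc, mul_inv_cancel₀ hpos.ne', one_mul]

/-- **Chae 2010, Corollary 1.1, from Theorem 1.1** (J. Funct. Anal. 258 (2010), Cor 1.1:
"There exists no self-similar blow-up for the solution of the 3D Euler equations with the blow-up
profile `V̄` satisfying `‖∇V̄‖_{L^∞} < 1`"; printed proof: for `v` of the form (1.2)–(1.3),
`M(T) = ‖∇V̄‖_{L^∞}`, so Theorem 1.1 applies). **Statement.** Under `chae2010_euler_typeI_threshold`:
if a classical unforced Euler solution `(u, p)` on `ℝ³ × [0, T)` of the Beale–Kato–Majda class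
coincides on `[t₀, T)`, `t₀ ∈ [0, T)`, with the exact power-law ansatz
`selfSimilarCollapse γ T U` (`u(t,x) = (T−t)^{γ−1} U(x/(T−t)^γ)`; any exponent `γ`, Chae's
`α = 1/γ − 1`) whose profile has `‖DU(y)‖ ≤ M₀ < 1` for all `y`, then `u` continues in the class
past `T` — `T` is not a blow-up time. Equivalently: an exact self-similar Euler blow-up profile in
this class has `sup ‖DU‖ ≥ 1` (a scale-invariant floor: the profile equation is invariant under
`U ↦ λ⁻¹U(λ·)`). [cite: Chae2010, Cor 1.1 (JFA §1)] -/
theorem chae2010_euler_typeI_threshold.selfSimilarCollapse_continues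
    (h : chae2010_euler_typeI_threshold) {T : ℝ} (hT : 0 < T) {u : ℝ → ℝ³ → ℝ³} {p : ℝ → ℝ³ → ℝ}
    (hsol : IsClassicalEulerSolutionOn (Ico 0 T) 0 u p)
    (hreg : ∀ T'' < T, HasBoundedSobolevNormsOn (Icc 0 T'') u)
    {γ : ℝ} {U : ℝ³ → ℝ³} {t₀ : ℝ} (ht₀ : t₀ ∈ Ico 0 T)
    (hrepr : ∀ t ∈ Ico t₀ T, u t = selfSimilarCollapse γ T U t)
    {M₀ : ℝ} (hM₀ : M₀ < 1) (hDU : ∀ y : ℝ³, ‖fderiv ℝ U y‖ ≤ M₀) :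
    HasSobolevExtensionPast 0 u T := by
  refine h hT hsol hreg ⟨M₀, hM₀, t₀, ht₀, fun t ht x => ?_⟩
  rw [hrepr t ht, mul_norm_fderiv_selfSimilarCollapse ht.2 U x]
  exact hDU _

/-- The same corollary in blow-up form: under `chae2010_euler_typeI_threshold`, if `T` IS a blow-up
time of the class (no continuation past `T`) and the solution is the exact power-law ansatz on
`[t₀, T)` with a profile of bounded gradient, then `sup_y ‖DU(y)‖ ≥ 1` — for every `M₀ < 1` some
`y` has `‖DU(y)‖ > M₀`. [cite: Chae2010, Cor 1.1] -/
theorem chae2010_euler_typeI_threshold.exists_norm_fderiv_gt_of_blowup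
    (h : chae2010_euler_typeI_threshold) {T : ℝ} (hT : 0 < T) {u : ℝ → ℝ³ → ℝ³} {p : ℝ → ℝ³ → ℝ}
    (hsol : IsClassicalEulerSolutionOn (Ico 0 T) 0 u p)
    (hreg : ∀ T'' < T, HasBoundedSobolevNormsOn (Icc 0 T'') u)
    (hblowup : ¬ HasSobolevExtensionPast 0 u T)
    {γ : ℝ} {U : ℝ³ → ℝ³} {t₀ : ℝ} (ht₀ : t₀ ∈ Ico 0 T)
    (hrepr : ∀ t ∈ Ico t₀ T, u t = selfSimilarCollapse γ T U t)
    {M₀ : ℝ} (hM₀ : M₀ < 1) : ∃ y : ℝ³, M₀ < ‖fderiv ℝ U y‖ := by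
  by_contra hcon
  push Not at hcon
  exact hblowup (h.selfSimilarCollapse_continues hT hsol hreg ht₀ hrepr hM₀ hcon)

/-! ### Appendix (proved): the rescaled form of the Type-II deviation, and the dilation
invariance of the gradient floor -/

/-- **The Type-II deviation is the `L^p` distance of the rescaled slice from the profile**:
for `t < T` and `0 < p < ∞`, with `λ = (T−t)^{γ/2}`,
`chaeTypeIIDeviation T γ p v V t = ‖λ v(λ·, t) − V‖_{L^p}` — the form
"`lim_{s→∞} ‖V(·,s) − V̄‖_{L^p} = 0`" in which Chae's proof uses the hypothesis of Theorem 1.4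
(arXiv §3: "The hypothesis (3.1) is now translated as …"), which pins the reading of the printed
display adopted in `chaeTypeIIDeviation`. By the `L^p` scaling law `‖c u₀(c·)‖_p = c^{1−3/p}‖u₀‖_p`
(`eLpNorm_nsRescaleData`, hypothesis `hscale`, discharged in the tree as
`eLpNorm_nsRescaleData_holds`) applied to `u₀ = v(t) − λ⁻¹V(λ⁻¹·)`, `c = λ`, and
`λ^{1−3/p} = (T−t)^{(p−3)γ/(2p)}`. [cite: Chae2010, Thm 1.4 (proof, the translated hypothesis; arXiv:0711.1113 §3)] -/
theorem chaeTypeIIDeviation_eq_eLpNorm_rescale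
    (hscale : eLpNorm_nsRescaleData (E := ℝ³) (F := ℝ³)) {T γ : ℝ} {p : ℝ≥0} (hp : p ≠ 0)
    (v : ℝ → ℝ³ → ℝ³) (V : ℝ³ → ℝ³) {t : ℝ} (ht : t < T) :
    chaeTypeIIDeviation T γ p v V t =
      eLpNorm (fun y => (T - t) ^ (γ / 2) • v t ((T - t) ^ (γ / 2) • y) - V y) (p : ℝ≥0∞) volume := by
  have hTt : 0 < T - t := sub_pos.2 ht
  set lam : ℝ := (T - t) ^ (γ / 2) with hlam
  have hlam0 : 0 < lam := Real.rpow_pos_of_pos hTt _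
  set w : ℝ³ → ℝ³ := fun x => v t x - lam⁻¹ • V (lam⁻¹ • x) with hw
  -- the rescaled field is `nsRescaleData lam w`
  have hresc : (fun y => lam • v t (lam • y) - V y) = nsRescaleData lam w := by
    funext y
    rw [nsRescaleData_apply, hw]
    simp only [smul_sub, smul_smul, mul_inv_cancel₀ hlam0.ne', one_smul, inv_mul_cancel₀ hlam0.ne']
  have hp0 : (p : ℝ≥0∞) ≠ 0 := by exact_mod_cast hp
  have key := hscale (μ := (volume : Measure ℝ³)) w hlam0 (p := (p : ℝ≥0∞)) hp0 ENNReal.coe_ne_top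
  rw [finrank_euclideanSpace_fin] at key
  rw [hresc, key, chaeTypeIIDeviation_def]
  congr 2
  -- `lam^{1 − 3/p} = (T−t)^{(p−3)γ/(2p)}`
  have hp' : ((p : ℝ≥0∞)).toReal = (p : ℝ) := ENNReal.coe_toReal p
  rw [hp', hlam, ← Real.rpow_mul hTt.le]
  congr 1
  have hpR : (p : ℝ) ≠ 0 := by exact_mod_cast hp
  push_cast
  field_simp

section Dilation

variable {E : Type*} [NormedAddCommGroup E] [InnerProductSpace ℝ E] [FiniteDimensional ℝ E]

/-- **Dilation invariance of the self-similar Euler profile equation** (the scaling (1.1) of the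
Euler equations, `v ↦ λ^α v(λx, λ^{α+1}t)`, restricted to the profile system (1.4)/(3.3) with
centre `0`): if `(U, P)` is a profile with exponent `γ`, so is `(l⁻¹U(l·), l⁻²P(l·))` for every
`l` (for `l = 0` this is the trivial profile). [cite: Chae2010, §1 (1.1)–(1.4)] -/
theorem IsSelfSimilarEulerProfile.dilate {γ : ℝ} {U : E → E} {P : E → ℝ}
    (h : IsSelfSimilarEulerProfile γ (0 : E) U P) (l : ℝ) :
    IsSelfSimilarEulerProfile γ (0 : E) (fun y => l⁻¹ • U (l • y))
      (fun y => (l⁻¹) ^ 2 * P (l • y)) where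
  contDiff_velocity := (h.contDiff_velocity.comp (contDiff_const_smul l)).const_smul l⁻¹
  contDiff_pressure := contDiff_const.mul (h.contDiff_pressure.comp (contDiff_const_smul l))
  profile_eq y := by
    by_cases hl : l = 0
    · subst hl
      have e := h.profile_eq 0
      simp only [sub_zero, smul_zero, zero_smul] at e ⊢
      simp only [inv_zero, zero_smul, smul_zero, zero_add, ne_eq, OfNat.ofNat_ne_zero,
        not_false_eq_true, zero_pow, zero_mul]
      have h1 : fderiv ℝ (fun _ : E => (0 : E)) y = 0 := by simp
      have h2 : gradient (fun _ : E => (0 : ℝ)) y = 0 := by simp [gradient]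
      rw [h1, h2]; simp
    have hgrad : gradient (fun y => (l⁻¹) ^ 2 * P (l • y)) y = l⁻¹ • gradient P (l • y) := by
      have hfun : (fun y => (l⁻¹) ^ 2 * P (l • y)) = fun y => (l⁻¹) ^ 2 • P (l • y) := rfl
      rw [hfun, gradient, fderiv_const_smul_comp_smul' P ((l⁻¹) ^ 2) l y, map_smul, gradient,
        show (l⁻¹) ^ 2 * l = l⁻¹ by field_simp]
    have hD : fderiv ℝ (fun y => l⁻¹ • U (l • y)) y = (l⁻¹ * l) • fderiv ℝ U (l • y) :=
      fderiv_const_smul_comp_smul' U l⁻¹ l y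
    rw [hD, hgrad, inv_mul_cancel₀ hl, one_smul, sub_zero]
    have e := h.profile_eq (l • y)
    rw [sub_zero] at e
    have hlin : fderiv ℝ U (l • y) (γ • y + l⁻¹ • U (l • y)) =
        l⁻¹ • fderiv ℝ U (l • y) (γ • (l • y) + U (l • y)) := by
      rw [← map_smul]
      congr 1
      rw [smul_add, smul_smul, smul_smul, show l⁻¹ * γ * l = γ by field_simp]
    rw [hlin, smul_comm (1 - γ) l⁻¹ (U (l • y)), ← smul_add, ← smul_add, e, smul_zero]
  divFree y := by
    have hx := h.divFree (l • y)
    simp only [VectorCalculus.divergence] at hx ⊢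
    rw [fderiv_const_smul_comp_smul' U l⁻¹ l y, ContinuousLinearMap.toLinearMap_smul, map_smul, hx,
      smul_zero]

omit [InnerProductSpace ℝ E] [FiniteDimensional ℝ E] in
/-- The gradient of the dilated profile at `y` is the gradient of the profile at `l y`:
`D(l⁻¹U(l·))(y) = DU(l y)` (`l ≠ 0`); hence `sup ‖DU‖` — the quantity of Chae's Corollary 1.1 /
`chae2010_euler_typeI_threshold.selfSimilarCollapse_continues` — is invariant under the dilation
symmetry `IsSelfSimilarEulerProfile.dilate` of the profile equation. [cite: Chae2010, Cor 1.1 with §1 (1.1)] -/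
theorem norm_fderiv_dilate [NormedSpace ℝ E] (U : E → E) {l : ℝ} (hl : l ≠ 0) (y : E) :
    ‖fderiv ℝ (fun y => l⁻¹ • U (l • y)) y‖ = ‖fderiv ℝ U (l • y)‖ := by
  rw [fderiv_const_smul_comp_smul' U l⁻¹ l y, inv_mul_cancel₀ hl, one_smul]

end Dilation

end Literature.Analysis.FluidPDE
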